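import Literature.NumberTheory.Transcendental.ManyCurveInduction
import HarnessLib

/-!
# Crux `RealOnePeriodRelations` (stmt-KontsevichZagierPeriods-10042),
# line `nash-retraction-thin-strip`, stub `stub_famSubAlg`:
# algebraic points of a connected algebraic subgroup of a family standard model come from its model

Baker–Wüstholz's induction over quotients AND subgroups (op. cit. Thm. 6.15, §6.8, p. 115: passage
to `B ∩ ker π`) for the FAMILY standard models `M = 𝔾ₘ^β × P` of
`Literature/NumberTheory/Transcendental/ManyCurveStd.lean` (lattice family `L : J → PeriodPair`,
class map `cls : γ → J`, algebraic points `GaGmEFam.Std.Alg`) needs, at GENERAL algebraic points,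
that the algebraic points of a connected algebraic subgroup `K₀ = H_{(A₀, C₀, Ξ₀)}` come from
algebraic points of its model: for the coordinates `S : GaGmEFam.Std.SubData D₀` of
`ManyCurveSub.lean` (integer vectors `a⁽ʲ⁾` spanning `A₀^⊥` with integer left inverse `pA`,
classwise integer vectors `m⁽ⁱ,ᵇ⁾` spanning `C₀^⊥` with classwise left inverses `pCC`, a
`ℚ̄`-basis `σ⁽ᵉ⁾` of `Ξ₀^⊥`, push-out matrix `κS`, embedding `ι : Lie(model) → Lie M`), if
`ι w ∈ Alg(M)` then `w ∈ Alg(model)`.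

The tree proves the TORSION version verbatim (`GaGmEFam.Std.SubData.mem_AlgTors_of_ι`,
`ManyCurveInduction.lean`); this file is its `Alg` half — the same classwise argument (a row of the
joint family pairs the blocks of its own class only: `sum_pCC_eq_sum_filter`,
`sum_mvv_eq_sum_filter`, each class with the invariants of its own lattice) without the final
torsion clause, exactly as the one-lattice `GaGmE.Std.SubData.mem_Alg_of_ι`
(`SemistabilityStdOfEngine.lean`) is the `Alg` half of `StdSubgroups.mem_AlgTors_of_ι`.

References: A. Baker, G. Wüstholz, *Logarithmic Forms and Diophantine Geometry*, New Math.
Monogr. 9, CUP 2007, Thm. 6.15, §6.7, §6.8 (p. 115). [BakerWustholz2007]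
-/

noncomputable section

open Complex Module Submodule

open Literature.NumberTheory.Transcendental

namespace Summit.KontsevichZagierPeriods.SymplecticScissors.RealOnePeriodRelations.MultiEllLayer

open LiePresentation (kPoints mem_kPoints kPoints_span_ofK ofK ofK_apply)
open GaGmE (Kbar)
open GaGmE.Std (iy iz is isAlgebraic_coe_Kbar)

/-- **Algebraic points of `K₀` come from algebraic points of its model** (the `Alg` half of the
tree's `GaGmEFam.Std.SubData.mem_AlgTors_of_ι`): for a family standard model `M = 𝔾ₘ^β × P` over
lattices `Λᵢ` with algebraic invariants and the coordinates `S` of a connected algebraic subgroup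
`K₀`, if `ι w ∈ Alg(M)` then `w ∈ Alg(model of K₀)` — torus part through the integer left inverse
`pA`, abelian part classwise through the classwise left inverses `pCC` (integer combinations of
`ℚ̄`-points of ONE `Eᵢ♮`), vector part by comparing coefficients along the `ℚ̄`-basis `σ⁽ᵉ⁾` of
`Ξ₀^⊥`. [cite: BakerWustholz2007, §6.8 (p. 115: passage to B ∩ ker π)] -/
theorem stub_famSubAlg {J : Type} [Fintype J] [DecidableEq J] {L : J → PeriodPair}
    (hL : ∀ i, IsAlgebraic ℚ (L i).g₂ ∧ IsAlgebraic ℚ (L i).g₃)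
    {β γ δ : Type} [Fintype β] [Fintype γ] [Fintype δ] {cls : γ → J} {κM : δ → γ → GaGmE.Kbar}
    {D₀ : GaGmEFam.Std.SubgroupData β γ δ cls κM} (S : GaGmEFam.Std.SubData D₀)
    {w : S.σ' → ℂ} (hw : S.ι w ∈ GaGmEFam.Std.Alg L cls κM) : w ∈ GaGmEFam.Std.Alg L S.cls' S.κS := by
  classical
  -- adapted from `GaGmEFam.Std.SubData.mem_AlgTors_of_ι` (ManyCurveInduction.lean) and
  -- `GaGmE.Std.SubData.mem_Alg_of_ι` (SemistabilityStdOfEngine.lean)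
  obtain ⟨hy, t, hzt, hs⟩ := hw
  -- the blocks of `w` through the integer left inverses
  have hwy : ∀ j', w (iy j') = ∑ i, (S.pA j' i : ℂ) * S.ι w (iy i) := fun j' => (S.pA_ι w j').symm
  have hwz : ∀ b', w (iz b') = ∑ k, (S.pCC b' k : ℂ) * S.ι w (iz k) := fun b' => (S.pC_ι w b').symm
  -- the new fibre representatives `t''_{b'} = ∑_k pCC_{b'k} t_k` and `t̂ = m t''`
  set t'' : S.B' → ℂ := fun b' => ∑ k, (S.pCC b' k : ℂ) * t k with ht''
  set that : γ → ℂ := fun k => ∑ b', (S.mvv b' k : ℂ) * t'' b' with hthat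
  -- `(w_z b', t''_b')` is a `ℚ̄`-point of `E_{cls' b'}♮`: only the blocks of class `b'.1` enter
  have hz'' : ∀ b', (L b'.1).IsUnivExtAlgPoint (w (iz b')) (t'' b') := by
    intro b'
    rw [hwz b', ht'']
    dsimp only
    rw [S.sum_pCC_eq_sum_filter, S.sum_pCC_eq_sum_filter]
    refine PeriodPair.IsUnivExtAlgPoint.sum_int_mul (hL b'.1).1 (hL b'.1).2 _ _ _ _ fun k hk => ?_
    have hk' : cls k = b'.1 := (Finset.mem_filter.mp hk).2
    rw [← hk']
    exact hzt k
  -- `((ι w)_z k, t̂_k)` is a `ℚ̄`-point of `E_{cls k}♮`: only the rows of class `cls k` enter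
  have hzhat : ∀ k, (L (cls k)).IsUnivExtAlgPoint (S.ι w (iz k)) (that k) := by
    intro k
    rw [S.ι_iz, hthat]
    dsimp only
    rw [S.sum_mvv_eq_sum_filter, S.sum_mvv_eq_sum_filter]
    refine PeriodPair.IsUnivExtAlgPoint.sum_int_mul (hL (cls k)).1 (hL (cls k)).2 _ _ _ _
      fun b' hb' => ?_
    have hb'' : b'.1 = cls k := (Finset.mem_filter.mp hb').2
    rw [← hb'']
    exact hz'' b'
  -- so `t - t̂` is algebraic
  have hu : ∀ k, IsAlgebraic ℚ (t k - that k) := by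
    intro k
    have hsub := (hzt k).sub (hL (cls k)).1 (hL (cls k)).2 (hzhat k)
    rw [sub_self] at hsub
    exact hsub.isAlgebraic_of_zero
  refine ⟨fun j' => ?_, t'', hz'', fun e' => ?_⟩
  · -- torus: `e^{w_y j'} = ∏ (e^{y_i})^{pA}`
    rw [hwy j', Complex.exp_sum]
    refine Finset.prod_induction _ (fun x => IsAlgebraic ℚ x) (fun a b ha hb => ha.mul hb)
      isAlgebraic_one fun i _ => ?_
    rw [Complex.exp_int_mul]
    exact isAlgebraic_zpow (hy i) _
  · -- fibre: the vector `W_e = w_s e - ∑ κ' t''` has `σ W` algebraic, hence is algebraic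
    set W : Fin S.nΞ → ℂ := fun e => w (is e) - ∑ b', (S.κS e b' : ℂ) * t'' b' with hW
    show IsAlgebraic ℚ (W e')
    have hκ : ∀ b' x, (∑ k, (κM x k : ℂ) * (S.mvv b' k : ℂ)) =
        ∑ e, (S.κS e b' : ℂ) * (S.sv e x : ℂ) := by
      intro b' x
      have := congrArg (algebraMap Kbar ℂ) (S.κS_spec b' x)
      simpa [map_sum, map_mul, GaGmEFam.Std.SubData.mvv] using this
    -- `∑_k κ_{xk} t̂_k = ∑_e σ_e(x) ∑_b' κ'_{eb'} t''_b'`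
    have hthat' : ∀ x, ∑ k, (κM x k : ℂ) * that k =
        ∑ e, (S.sv e x : ℂ) * ∑ b', (S.κS e b' : ℂ) * t'' b' := by
      intro x
      calc ∑ k, (κM x k : ℂ) * that k = ∑ b', (∑ k, (κM x k : ℂ) * (S.mvv b' k : ℂ)) * t'' b' := by
            simp only [hthat, Finset.mul_sum, Finset.sum_mul]
            rw [Finset.sum_comm]
            exact Finset.sum_congr rfl fun b' _ => Finset.sum_congr rfl fun k _ => by ring
        _ = ∑ b', (∑ e, (S.κS e b' : ℂ) * (S.sv e x : ℂ)) * t'' b' := by simp only [hκ]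
        _ = ∑ e, (S.sv e x : ℂ) * ∑ b', (S.κS e b' : ℂ) * t'' b' := by
            simp only [Finset.mul_sum, Finset.sum_mul]
            rw [Finset.sum_comm]
            exact Finset.sum_congr rfl fun e _ => Finset.sum_congr rfl fun b' _ => by ring
    -- `(σ W)_x = (ι w)_s(x) - ∑ κ t + ∑ κ (t - t̂)` is algebraic
    have hV : ∀ x, ∑ e, (S.sv e x : ℂ) * W e =
        (S.ι w (is x) - ∑ k, (κM x k : ℂ) * t k) + ∑ k, (κM x k : ℂ) * (t k - that k) := by
      intro x
      have e1 : ∑ e, (S.sv e x : ℂ) * W e = S.ι w (is x) - ∑ k, (κM x k : ℂ) * that k := by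
        rw [hthat' x, S.ι_is, ← Finset.sum_sub_distrib]
        exact Finset.sum_congr rfl fun e _ => by rw [hW]; ring
      rw [e1]
      simp only [mul_sub, Finset.sum_sub_distrib]
      ring
    have hValg : ∀ x, IsAlgebraic ℚ (∑ e, (S.sv e x : ℂ) * W e) := by
      intro x
      rw [hV x]
      refine (hs x).add ?_
      refine Finset.sum_induction _ (fun y => IsAlgebraic ℚ y) (fun a b ha hb => ha.add hb)
        isAlgebraic_zero fun k _ => (isAlgebraic_coe_Kbar (κM x k)).mul (hu k)
    -- `σ W` has algebraic coordinates: it is a `ℚ̄`-point of `span(σ)`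
    let VK : δ → Kbar := fun x =>
      ⟨∑ e, (S.sv e x : ℂ) * W e, mem_algebraicClosure_iff.mpr (hValg x)⟩
    have hVKx : ∀ x, ((VK x : Kbar) : ℂ) = ∑ e, (S.sv e x : ℂ) * W e := fun x => rfl
    have hVKmem : VK ∈ kPoints Kbar (span ℂ (ofK Kbar (L := ℂ) '' Set.range S.sv)) := by
      rw [mem_kPoints]
      have hofK : ofK Kbar (L := ℂ) VK = ∑ e, W e • ofK Kbar (L := ℂ) (S.sv e) := by
        funext x
        rw [ofK_apply, show algebraMap Kbar ℂ (VK x) = ((VK x : Kbar) : ℂ) from rfl, hVKx x]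
        simp only [Finset.sum_apply, Pi.smul_apply, smul_eq_mul, ofK_apply]
        exact Finset.sum_congr rfl fun e _ => by rw [mul_comm]; rfl
      rw [hofK]
      exact Submodule.sum_mem _ fun e _ =>
        Submodule.smul_mem _ _ (subset_span ⟨S.sv e, ⟨e, rfl⟩, rfl⟩)
    rw [kPoints_span_ofK, Submodule.mem_span_range_iff_exists_fun] at hVKmem
    obtain ⟨c, hc⟩ := hVKmem
    -- compare coefficients along the basis `σ`: `W = c`
    have hWc : (fun e => W e - (c e : ℂ)) = 0 := by
      refine S.eq_zero_of_sv_sum fun x => ?_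
      have h2 : ∑ e, (S.sv e x : ℂ) * (c e : ℂ) = ∑ e, (S.sv e x : ℂ) * W e := by
        rw [← hVKx x, show ((VK x : Kbar) : ℂ) = algebraMap Kbar ℂ (VK x) from rfl,
          ← congr_fun hc x]
        simp only [Finset.sum_apply, Pi.smul_apply, smul_eq_mul, map_sum, map_mul]
        exact Finset.sum_congr rfl fun e _ => by rw [mul_comm]; rfl
      simp only [mul_sub, Finset.sum_sub_distrib, h2, sub_self]
    have := congr_fun hWc e'
    simp only [Pi.zero_apply, sub_eq_zero] at this
    rw [this]
    exact isAlgebraic_coe_Kbar (c e')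

end Summit.KontsevichZagierPeriods.SymplecticScissors.RealOnePeriodRelations.MultiEllLayer

end
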